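import Mathlib
import Summits.KontsevichZagierPeriods.KontsevichZagierPeriods.Theorems.InverseLandauTateFamilyKernelTateAnchor

/-!
# Crux `TateFamilyKernel` (stmt-KontsevichZagierPeriods-9130), line `Sketch` — stub `stub_derivFamily`

Derivative families for the lead's skeleton of the crux
`Summit.KontsevichZagierPeriods.KontsevichZagierPeriods.Theses.InverseLandau.TateFamilyKernel`:
for a rational family `P/Q` (`ℚ`-polynomials in the cube variables `z ∈ [0,1]^D` and the parameter
`ϖ`, the last variable) with `Q ≠ 0` on `[0,1]^D × (0,ε)` and identically vanishing open-cube
integrals `∫_{(0,1)^D} P/Q(z,ϖ) dz = 0` on `(0,ε)`, the `ϖ`-DERIVATIVE family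
`∂_ϖ(P/Q) = (∂_ϖP·Q − P·∂_ϖQ)/Q²` again has identically vanishing open-cube integrals on `(0,ε)`.

Pure real analysis: differentiation under the integral sign
(`hasDerivAt_integral_of_dominated_loc_of_deriv_le`) on the finite-measure set `∏ᵢ (0,1)`, with the
parameter ranging over a compact interval `[ϖ/2, (ϖ+ε)/2] ⊂ (0,ε)` around `ϖ`; the integrand and its
`ϖ`-derivative (quotient rule in the last slot, `KZ.hasDerivAt_aeval_div_aeval_update`) are continuous
on the compact `[0,1]^D × [ϖ/2, (ϖ+ε)/2]`, where `Q ≠ 0`, hence uniformly bounded; and the integral, being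
identically zero near `ϖ`, has derivative zero there (uniqueness of derivatives). No named fact, no new
definition.
-/

noncomputable section

open MeasureTheory Set MvPolynomial
open Literature.NumberTheory.Transcendental
open Literature.ModelTheory.ExponentialFields (continuous_aeval_real)

namespace Summit.KontsevichZagierPeriods.InverseLandau.TateFamilyKernel.Descent

variable {D : ℕ}

/-- Joint continuity of `(z, ϖ) ↦ R(z, ϖ)` for a `ℚ`-polynomial `R` in `D + 1` real variables, the
parameter `ϖ` in the last slot. [folklore] -/
theorem continuous_aeval_snoc_prod (R : MvPolynomial (Fin (D + 1)) ℚ) :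
    Continuous fun p : (Fin D → ℝ) × ℝ => aeval (Fin.snoc p.1 p.2 : Fin (D + 1) → ℝ) R :=
  (continuous_aeval_real R).comp
    (Continuous.finSnoc (A := fun _ : Fin (D + 1) => ℝ) continuous_fst continuous_snd)

/-- Continuity of the slice `z ↦ R(z, ϖ)` of a `ℚ`-polynomial `R` in `D + 1` real variables at a fixed
parameter `ϖ`. [folklore] -/
theorem continuous_aeval_snoc_slice (R : MvPolynomial (Fin (D + 1)) ℚ) (ϖ : ℝ) :
    Continuous fun z : Fin D → ℝ => aeval (Fin.snoc z ϖ : Fin (D + 1) → ℝ) R :=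
  (continuous_aeval_real R).comp
    (Continuous.finSnoc (A := fun _ : Fin (D + 1) => ℝ) continuous_id continuous_const)

/-- **Quotient rule in the parameter.** For fixed `z` with `Q(z, ϖ) ≠ 0`:
`d/dx [P(z,x)/Q(z,x)]|_{x=ϖ} = ((∂_ϖP·Q − P·∂_ϖQ)/Q²)(z, ϖ)`, `∂_ϖ = MvPolynomial.pderiv (Fin.last D)`.
[folklore] -/
theorem hasDerivAt_aeval_div_aeval_snoc (P Q : MvPolynomial (Fin (D + 1)) ℚ) (z : Fin D → ℝ) (ϖ : ℝ)
    (hQ : aeval (Fin.snoc z ϖ : Fin (D + 1) → ℝ) Q ≠ 0) :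
    HasDerivAt (fun x : ℝ => aeval (Fin.snoc z x : Fin (D + 1) → ℝ) P /
        aeval (Fin.snoc z x : Fin (D + 1) → ℝ) Q)
      (aeval (Fin.snoc z ϖ : Fin (D + 1) → ℝ) (pderiv (Fin.last D) P * Q - P * pderiv (Fin.last D) Q) /
        aeval (Fin.snoc z ϖ : Fin (D + 1) → ℝ) (Q ^ 2)) ϖ := by
  have hpt : Function.update (Fin.snoc z ϖ : Fin (D + 1) → ℝ) (Fin.last D) ϖ = Fin.snoc z ϖ :=
    Fin.update_snoc_last _ _ _
  have h := KZ.hasDerivAt_aeval_div_aeval_update P Q (Fin.snoc z ϖ : Fin (D + 1) → ℝ) (Fin.last D) ϖ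
    (by rw [hpt]; exact hQ)
  rw [hpt] at h
  have hfun : (fun x : ℝ => aeval (Fin.snoc z x : Fin (D + 1) → ℝ) P /
      aeval (Fin.snoc z x : Fin (D + 1) → ℝ) Q) =
      fun x => aeval (Function.update (Fin.snoc z ϖ : Fin (D + 1) → ℝ) (Fin.last D) x) P /
        aeval (Function.update (Fin.snoc z ϖ : Fin (D + 1) → ℝ) (Fin.last D) x) Q := by
    funext x
    rw [Fin.update_snoc_last]
  rw [hfun]
  refine h.congr_deriv ?_
  simp only [map_sub, map_mul, map_pow]

/-- **Derivative families** (stub `stub_derivFamily` of the crux `TateFamilyKernel`, line `Sketch`).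
For a rational family `P/Q` with `Q ≠ 0` on `[0,1]^D × (0,ε)` and identically vanishing open-cube
integrals on `(0,ε)`, the `ϖ`-derivative family `∂_ϖ(P/Q) = (∂_ϖP·Q − P·∂_ϖQ)/Q²` (again rational, same
admissibility, Tate if `Q` is) has identically vanishing open-cube integrals on `(0,ε)`:
differentiation under the integral sign (the integrand and its `ϖ`-derivative are continuous, hence
bounded, on the compact `[0,1]^D × [ϖ/2, (ϖ+ε)/2] ⊂ [0,1]^D × (0,ε)`;
`hasDerivAt_integral_of_dominated_loc_of_deriv_le`), and the derivative of the zero function is zero.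
[cite: KontsevichZagier2001, §1.2] -/
theorem stub_derivFamily (D : ℕ) (P Q : MvPolynomial (Fin (D + 1)) ℚ) (ε : ℝ)
    (hadm : ∀ (z : Fin D → ℝ) (ϖ : ℝ), (∀ t, z t ∈ Icc (0 : ℝ) 1) → ϖ ∈ Ioo 0 ε →
      aeval (Fin.snoc z ϖ : Fin (D + 1) → ℝ) Q ≠ 0)
    (hvan : ∀ ϖ ∈ Ioo 0 ε, ∫ z in Set.pi Set.univ (fun _ : Fin D => Ioo (0 : ℝ) 1),
      aeval (Fin.snoc z ϖ : Fin (D + 1) → ℝ) P / aeval (Fin.snoc z ϖ : Fin (D + 1) → ℝ) Q = 0) :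
    ∀ ϖ ∈ Ioo 0 ε, ∫ z in Set.pi Set.univ (fun _ : Fin D => Ioo (0 : ℝ) 1),
      aeval (Fin.snoc z ϖ : Fin (D + 1) → ℝ) (pderiv (Fin.last D) P * Q - P * pderiv (Fin.last D) Q) /
        aeval (Fin.snoc z ϖ : Fin (D + 1) → ℝ) (Q ^ 2) = 0 := by
  intro ϖ hϖ
  -- notation: the open cube `S`, the numerator `N` of the derivative, the family `F` and its derivative `F'`
  set S : Set (Fin D → ℝ) := Set.pi Set.univ (fun _ : Fin D => Ioo (0 : ℝ) 1) with hS
  set N : MvPolynomial (Fin (D + 1)) ℚ := pderiv (Fin.last D) P * Q - P * pderiv (Fin.last D) Q with hN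
  set F : ℝ → (Fin D → ℝ) → ℝ := fun x z =>
    aeval (Fin.snoc z x : Fin (D + 1) → ℝ) P / aeval (Fin.snoc z x : Fin (D + 1) → ℝ) Q with hF
  set F' : ℝ → (Fin D → ℝ) → ℝ := fun x z =>
    aeval (Fin.snoc z x : Fin (D + 1) → ℝ) N / aeval (Fin.snoc z x : Fin (D + 1) → ℝ) (Q ^ 2) with hF'
  -- a compact parameter interval `[a, b]` around `ϖ` inside `(0, ε)`
  set a : ℝ := ϖ / 2 with ha
  set b : ℝ := (ϖ + ε) / 2 with hb
  have haϖ : a < ϖ := by rw [ha]; linarith [hϖ.1]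
  have hϖb : ϖ < b := by rw [hb]; linarith [hϖ.2]
  have hsub : Icc a b ⊆ Ioo 0 ε := fun x hx =>
    ⟨by rw [ha] at hx; linarith [hx.1, hϖ.1], by rw [hb] at hx; linarith [hx.2, hϖ.2]⟩
  have hs : Icc a b ∈ nhds ϖ := Icc_mem_nhds haϖ hϖb
  -- the open cube: measurable, inside the closed cube, of finite measure
  have hSm : MeasurableSet S := MeasurableSet.univ_pi fun _ => measurableSet_Ioo
  have hScube : ∀ z ∈ S, ∀ t, z t ∈ Icc (0 : ℝ) 1 := fun z hz t =>
    Ioo_subset_Icc_self ((Set.mem_univ_pi.1 hz) t)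
  have hSIcc : S ⊆ Icc (0 : Fin D → ℝ) 1 := fun z hz =>
    ⟨fun t => (hScube z hz t).1, fun t => (hScube z hz t).2⟩
  haveI : IsFiniteMeasure (volume.restrict S) :=
    isFiniteMeasure_restrict.2 (lt_of_le_of_lt (measure_mono hSIcc) isCompact_Icc.measure_lt_top).ne
  -- `Q ≠ 0` on the closed cube times `[a, b]`
  have hQ : ∀ z : Fin D → ℝ, (∀ t, z t ∈ Icc (0 : ℝ) 1) → ∀ x ∈ Icc a b,
      aeval (Fin.snoc z x : Fin (D + 1) → ℝ) Q ≠ 0 := fun z hz x hx => hadm z x hz (hsub hx)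
  -- measurability of the family and of its derivative
  have hFm : ∀ x, AEStronglyMeasurable (F x) (volume.restrict S) := fun x =>
    ((continuous_aeval_snoc_slice P x).measurable.div
      (continuous_aeval_snoc_slice Q x).measurable).aestronglyMeasurable
  have hF'm : AEStronglyMeasurable (F' ϖ) (volume.restrict S) :=
    ((continuous_aeval_snoc_slice N ϖ).measurable.div
      (continuous_aeval_snoc_slice (Q ^ 2) ϖ).measurable).aestronglyMeasurable
  -- integrability of the family at `ϖ` (continuous on the compact closed cube)
  have hFint : Integrable (F ϖ) (volume.restrict S) := by
    have hc : ContinuousOn (F ϖ) (Icc (0 : Fin D → ℝ) 1) :=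
      (continuous_aeval_snoc_slice P ϖ).continuousOn.div (continuous_aeval_snoc_slice Q ϖ).continuousOn
        fun z hz => hQ z (fun t => ⟨hz.1 t, hz.2 t⟩) ϖ ⟨haϖ.le, hϖb.le⟩
    exact (hc.integrableOn_compact isCompact_Icc).mono_set hSIcc
  -- a uniform bound of the derivative on the closed cube times `[a, b]`
  have hcont : ContinuousOn (fun p : (Fin D → ℝ) × ℝ =>
      aeval (Fin.snoc p.1 p.2 : Fin (D + 1) → ℝ) N / aeval (Fin.snoc p.1 p.2 : Fin (D + 1) → ℝ) (Q ^ 2))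
      (Icc (0 : Fin D → ℝ) 1 ×ˢ Icc a b) := by
    refine (continuous_aeval_snoc_prod N).continuousOn.div (continuous_aeval_snoc_prod (Q ^ 2)).continuousOn
      fun p hp => ?_
    rw [map_pow]
    exact pow_ne_zero 2 (hQ p.1 (fun t => ⟨hp.1.1 t, hp.1.2 t⟩) p.2 hp.2)
  obtain ⟨C, hC⟩ := (isCompact_Icc.prod isCompact_Icc).exists_bound_of_continuousOn hcont
  have hbound : ∀ᵐ z ∂(volume.restrict S), ∀ x ∈ Icc a b, ‖F' x z‖ ≤ C :=
    ae_restrict_of_forall_mem hSm fun z hz x hx => hC (z, x) ⟨hSIcc hz, hx⟩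
  -- pointwise differentiability in the parameter
  have hdiff : ∀ᵐ z ∂(volume.restrict S), ∀ x ∈ Icc a b, HasDerivAt (F · z) (F' x z) x :=
    ae_restrict_of_forall_mem hSm fun z hz x hx =>
      hasDerivAt_aeval_div_aeval_snoc P Q z x (hQ z (hScube z hz) x hx)
  -- differentiation under the integral sign
  have hkey := (hasDerivAt_integral_of_dominated_loc_of_deriv_le (bound := fun _ => C) hs
    (Filter.Eventually.of_forall hFm) hFint hF'm hbound (integrable_const C) hdiff).2
  -- the integral vanishes identically near `ϖ`, so its derivative there is zero
  have hzero : (fun x => ∫ z, F x z ∂(volume.restrict S)) =ᶠ[nhds ϖ] fun _ => (0 : ℝ) := by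
    filter_upwards [Ioo_mem_nhds hϖ.1 hϖ.2] with x hx
    exact hvan x hx
  exact hkey.unique ((hasDerivAt_const ϖ (0 : ℝ)).congr_of_eventuallyEq hzero)

end Summit.KontsevichZagierPeriods.InverseLandau.TateFamilyKernel.Descent

end
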